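import Literature.NumberTheory.Transcendental.BakerRealLogarithms
import HarnessLib

/-!
# Baker's theorem as a decomposition of vanishing linear forms in real logarithms

A corollary of Baker's Theorem 2.1 in its real coefficient form
(`Literature.NumberTheory.Transcendental.baker_real_coeff`, proved in the tree): if
`r + Σ_i γ_i ℓ_i = 0` with `r, γ_i` real algebraic and `ℓ_i` real numbers with `exp ℓ_i` algebraic
(real logarithms of positive algebraic numbers), then `r = 0` and the coefficient vector `γ` is an
ALGEBRAIC COMBINATION OF RATIONAL EXACT RELATIONS among the `ℓ_i`: there are vectors
`N_j ∈ ℚ^ι` with `Σ_i N_{ji} ℓ_i = 0` and `γ_i = Σ_j γ_j N_{ji}` (`baker_decomposition`). Proof: choose a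
`ℚ`-basis of the `ℚ`-span of the `ℓ_i` among the `ℓ_i` (`exists_linearIndependent'`), expand, apply
`baker_real_coeff` to the basis, and take `N_j := e_j − (coordinates of ℓ_j)`. This is the form in
which Baker's theorem is consumed by functional-lifting arguments (a vanishing combination of
logarithms of algebraic FUNCTIONS specialised at an algebraic point is a combination of
logarithms of functions taking the value `1` there).

Everything is proved; no `def`, no named fact.

## References
* A. Baker, *Transcendental Number Theory*, CUP 1975, Ch. 2, Theorem 2.1. [`Baker1975`]
-/

noncomputable section

open scoped BigOperators

namespace Literature.NumberTheory.Transcendental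

/-- **Baker decomposition.** If `r + Σ_i γ_i ℓ_i = 0` with `r, γ_i` real algebraic and `ℓ_i` real
logarithms of algebraic numbers (`exp ℓ_i` algebraic), then `r = 0` and `γ` is an algebraic
combination of RATIONAL exact relations among the `ℓ_i`: there are `N_j ∈ ℚ^ι` (`j ∈ ι`) with
`Σ_i N_{ji} ℓ_i = 0` and `γ_i = Σ_j γ_j N_{ji}`. (Choose a `ℚ`-basis `ℓ ∘ a` of the span; write
`ℓ_i = Σ_κ q_{iκ} ℓ_{aκ}`; Baker's theorem in coefficient form kills `r` and every `Σ_i γ_i q_{iκ}`;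
take `N_j := e_j − Σ_κ q_{jκ} e_{aκ}`.) [cite: Baker1975, Theorem 2.1] -/
theorem baker_decomposition {ι : Type} [Fintype ι] [DecidableEq ι] (ℓ : ι → ℝ)
    (halg : ∀ i, IsAlgebraic ℚ (Real.exp (ℓ i))) {r : ℝ} (hr : IsAlgebraic ℚ r) {γ : ι → ℝ}
    (hγ : ∀ i, IsAlgebraic ℚ (γ i)) (h : r + ∑ i, γ i * ℓ i = 0) :
    r = 0 ∧ ∃ N : ι → ι → ℚ, (∀ j, ∑ i, (N j i : ℝ) * ℓ i = 0) ∧ ∀ i, γ i = ∑ j, γ j * N j i := by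
  classical
  obtain ⟨κ, a, ha, hspan, hli⟩ := exists_linearIndependent' (K := ℚ) ℓ
  haveI : Finite κ := Finite.of_injective a ha
  letI : Fintype κ := Fintype.ofFinite κ
  -- coordinates of each `ℓ i` in the basis `ℓ ∘ a`
  have hmem : ∀ i, ℓ i ∈ Submodule.span ℚ (Set.range (ℓ ∘ a)) := fun i => by
    rw [hspan]; exact Submodule.subset_span ⟨i, rfl⟩
  choose q hq using fun i => (Submodule.mem_span_range_iff_exists_fun (R := ℚ)).mp (hmem i)
  -- hq i : ∑ k, q i k • (ℓ ∘ a) k = ℓ i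
  have hq' : ∀ i, ℓ i = ∑ k, (q i k : ℝ) * ℓ (a k) := fun i => by
    rw [← hq i]
    exact Finset.sum_congr rfl fun k _ => by simp [Rat.smul_def]
  -- the relation in the basis
  have hswap : ∑ i, γ i * ℓ i = ∑ k, (∑ i, γ i * (q i k : ℝ)) * ℓ (a k) := by
    calc ∑ i, γ i * ℓ i = ∑ i, ∑ k, γ i * (q i k : ℝ) * ℓ (a k) :=
          Finset.sum_congr rfl fun i _ => by rw [hq' i, Finset.mul_sum]; simp only [mul_assoc]
      _ = ∑ k, ∑ i, γ i * (q i k : ℝ) * ℓ (a k) := Finset.sum_comm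
      _ = ∑ k, (∑ i, γ i * (q i k : ℝ)) * ℓ (a k) :=
          Finset.sum_congr rfl fun k _ => by rw [Finset.sum_mul]
  have hrel : r + ∑ k, (∑ i, γ i * (q i k : ℝ)) * ℓ (a k) = 0 := by rw [← hswap]; exact h
  have hβalg : ∀ k, IsAlgebraic ℚ (∑ i, γ i * (q i k : ℝ)) := fun k => by
    induction (Finset.univ : Finset ι) using Finset.induction_on with
    | empty => simpa using isAlgebraic_zero
    | insert b s hb ih =>
      rw [Finset.sum_insert hb]
      exact ((hγ b).mul (isAlgebraic_algebraMap (q b k))).add ih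
  obtain ⟨hr0, hβ0⟩ := baker_real_coeff (ℓ ∘ a) (fun k => halg (a k)) hli hr hβalg hrel
  -- the rational relation vectors `N j = e_j − Σ_k q_{jk} e_{a k}`
  set N : ι → ι → ℚ := fun j i => (if i = j then 1 else 0) - ∑ k, (if a k = i then q j k else 0)
    with hN
  have hNcast : ∀ j i, ((N j i : ℚ) : ℝ) =
      (if i = j then (1:ℝ) else 0) - ∑ k, (if a k = i then (q j k : ℝ) else 0) := by
    intro j i
    simp only [hN, Rat.cast_sub, Rat.cast_sum]
    congr 1
    · split_ifs <;> simp
    · exact Finset.sum_congr rfl fun k _ => by split_ifs <;> simp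
  refine ⟨hr0, N, fun j => ?_, fun i => ?_⟩
  · -- `Σ_i N_{ji} ℓ_i = ℓ_j − Σ_k q_{jk} ℓ_{a k} = 0`
    have h1 : ∑ i, (if i = j then (1:ℝ) else 0) * ℓ i = ℓ j := by
      simp only [ite_mul, one_mul, zero_mul, Finset.sum_ite_eq', Finset.mem_univ, if_true]
    have h2 : ∑ i, (∑ k, (if a k = i then (q j k : ℝ) else 0)) * ℓ i =
        ∑ k, (q j k : ℝ) * ℓ (a k) := by
      calc ∑ i, (∑ k, (if a k = i then (q j k : ℝ) else 0)) * ℓ i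
            = ∑ i, ∑ k, (if a k = i then (q j k : ℝ) * ℓ i else 0) :=
              Finset.sum_congr rfl fun i _ => by
                rw [Finset.sum_mul]
                exact Finset.sum_congr rfl fun k _ => by split_ifs <;> simp
        _ = ∑ k, ∑ i, (if a k = i then (q j k : ℝ) * ℓ i else 0) := Finset.sum_comm
        _ = ∑ k, (q j k : ℝ) * ℓ (a k) :=
              Finset.sum_congr rfl fun k _ => by
                rw [Finset.sum_ite_eq]; simp
    simp_rw [hNcast, sub_mul, Finset.sum_sub_distrib, h1, h2, ← hq' j, sub_self]
  · -- `Σ_j γ_j N_{ji} = γ_i − Σ_k [a k = i] (Σ_j γ_j q_{jk}) = γ_i`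
    have h1 : ∑ j, γ j * (if i = j then (1:ℝ) else 0) = γ i := by
      simp only [mul_ite, mul_one, mul_zero, Finset.sum_ite_eq, Finset.mem_univ, if_true]
    have h2 : ∑ j, γ j * (∑ k, (if a k = i then (q j k : ℝ) else 0)) = 0 := by
      calc ∑ j, γ j * (∑ k, (if a k = i then (q j k : ℝ) else 0))
            = ∑ j, ∑ k, (if a k = i then γ j * (q j k : ℝ) else 0) :=
              Finset.sum_congr rfl fun j _ => by
                rw [Finset.mul_sum]
                exact Finset.sum_congr rfl fun k _ => by split_ifs <;> simp
        _ = ∑ k, ∑ j, (if a k = i then γ j * (q j k : ℝ) else 0) := Finset.sum_comm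
        _ = ∑ k, (if a k = i then ∑ j, γ j * (q j k : ℝ) else 0) :=
              Finset.sum_congr rfl fun k _ => by split_ifs <;> simp
        _ = 0 := by simp [hβ0]
    simp_rw [hNcast, mul_sub, Finset.sum_sub_distrib, h1, h2, sub_zero]

/-! ### The complex form -/

/-- **Baker's theorem, complex coefficient form.** If `l i` (`i` in a finite index type) are complex
numbers with `exp (l i)` algebraic, linearly independent over `ℚ`, and `β₀ + Σᵢ βᵢ · l i = 0` with
ALGEBRAIC `β₀, βᵢ ∈ ℂ`, then `β₀ = 0` and every `βᵢ = 0` (a finite relation over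
`algebraicClosure ℚ ℂ` among `1, (l i)ᵢ`, independent by `baker_holds`). [cite: Baker1975, Theorem 2.1] -/
theorem baker_coeff {ι : Type} [Fintype ι] (l : ι → ℂ)
    (halg : ∀ i, IsAlgebraic ℚ (Complex.exp (l i))) (hli : LinearIndependent ℚ l)
    {β₀ : ℂ} (hβ₀ : IsAlgebraic ℚ β₀) {β : ι → ℂ} (hβ : ∀ i, IsAlgebraic ℚ (β i))
    (h : β₀ + ∑ i, β i * l i = 0) : β₀ = 0 ∧ ∀ i, β i = 0 := by
  have hB := Fintype.linearIndependent_iff.mp (baker_holds l halg hli)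
    (fun o => o.elim ⟨β₀, mem_algebraicClosure_iff.mpr hβ₀⟩
      fun i => ⟨β i, mem_algebraicClosure_iff.mpr (hβ i)⟩)
    (by
      rw [Fintype.sum_option]
      simpa only [Option.elim_none, Option.elim_some, IntermediateField.smul_def, smul_eq_mul,
        mul_one] using h)
  exact ⟨congrArg Subtype.val (hB none), fun i => congrArg Subtype.val (hB (some i))⟩

/-- **Baker decomposition, complex form.** If `r + Σ_i γ_i ℓ_i = 0` with `r, γ_i ∈ ℂ` algebraic and
`ℓ_i ∈ ℂ` with `exp ℓ_i` algebraic (determinations of logarithms of algebraic numbers), then `r = 0`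
and `γ` is an algebraic combination of RATIONAL exact relations among the `ℓ_i`: there are
`N_j ∈ ℚ^ι` (`j ∈ ι`) with `Σ_i N_{ji} ℓ_i = 0` and `γ_i = Σ_j γ_j N_{ji}`. Same proof as the real
form, with `baker_coeff`. [cite: Baker1975, Theorem 2.1] -/
theorem baker_decomposition_complex {ι : Type} [Fintype ι] [DecidableEq ι] (ℓ : ι → ℂ)
    (halg : ∀ i, IsAlgebraic ℚ (Complex.exp (ℓ i))) {r : ℂ} (hr : IsAlgebraic ℚ r) {γ : ι → ℂ}
    (hγ : ∀ i, IsAlgebraic ℚ (γ i)) (h : r + ∑ i, γ i * ℓ i = 0) :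
    r = 0 ∧ ∃ N : ι → ι → ℚ, (∀ j, ∑ i, (N j i : ℂ) * ℓ i = 0) ∧ ∀ i, γ i = ∑ j, γ j * N j i := by
  classical
  obtain ⟨κ, a, ha, hspan, hli⟩ := exists_linearIndependent' (K := ℚ) ℓ
  haveI : Finite κ := Finite.of_injective a ha
  letI : Fintype κ := Fintype.ofFinite κ
  have hmem : ∀ i, ℓ i ∈ Submodule.span ℚ (Set.range (ℓ ∘ a)) := fun i => by
    rw [hspan]; exact Submodule.subset_span ⟨i, rfl⟩
  choose q hq using fun i => (Submodule.mem_span_range_iff_exists_fun (R := ℚ)).mp (hmem i)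
  have hq' : ∀ i, ℓ i = ∑ k, (q i k : ℂ) * ℓ (a k) := fun i => by
    rw [← hq i]
    exact Finset.sum_congr rfl fun k _ => by simp [Rat.smul_def]
  have hswap : ∑ i, γ i * ℓ i = ∑ k, (∑ i, γ i * (q i k : ℂ)) * ℓ (a k) := by
    calc ∑ i, γ i * ℓ i = ∑ i, ∑ k, γ i * (q i k : ℂ) * ℓ (a k) :=
          Finset.sum_congr rfl fun i _ => by rw [hq' i, Finset.mul_sum]; simp only [mul_assoc]
      _ = ∑ k, ∑ i, γ i * (q i k : ℂ) * ℓ (a k) := Finset.sum_comm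
      _ = ∑ k, (∑ i, γ i * (q i k : ℂ)) * ℓ (a k) :=
          Finset.sum_congr rfl fun k _ => by rw [Finset.sum_mul]
  have hrel : r + ∑ k, (∑ i, γ i * (q i k : ℂ)) * ℓ (a k) = 0 := by rw [← hswap]; exact h
  have hβalg : ∀ k, IsAlgebraic ℚ (∑ i, γ i * (q i k : ℂ)) := fun k => by
    induction (Finset.univ : Finset ι) using Finset.induction_on with
    | empty => simpa using isAlgebraic_zero
    | insert b s hb ih =>
      rw [Finset.sum_insert hb]
      exact ((hγ b).mul (isAlgebraic_algebraMap (q b k))).add ih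
  obtain ⟨hr0, hβ0⟩ := baker_coeff (ℓ ∘ a) (fun k => halg (a k)) hli hr hβalg hrel
  set N : ι → ι → ℚ := fun j i => (if i = j then 1 else 0) - ∑ k, (if a k = i then q j k else 0)
    with hN
  have hNcast : ∀ j i, ((N j i : ℚ) : ℂ) =
      (if i = j then (1:ℂ) else 0) - ∑ k, (if a k = i then (q j k : ℂ) else 0) := by
    intro j i
    simp only [hN, Rat.cast_sub, Rat.cast_sum]
    congr 1
    · split_ifs <;> simp
    · exact Finset.sum_congr rfl fun k _ => by split_ifs <;> simp
  refine ⟨hr0, N, fun j => ?_, fun i => ?_⟩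
  · have h1 : ∑ i, (if i = j then (1:ℂ) else 0) * ℓ i = ℓ j := by
      simp only [ite_mul, one_mul, zero_mul, Finset.sum_ite_eq', Finset.mem_univ, if_true]
    have h2 : ∑ i, (∑ k, (if a k = i then (q j k : ℂ) else 0)) * ℓ i =
        ∑ k, (q j k : ℂ) * ℓ (a k) := by
      calc ∑ i, (∑ k, (if a k = i then (q j k : ℂ) else 0)) * ℓ i
            = ∑ i, ∑ k, (if a k = i then (q j k : ℂ) * ℓ i else 0) :=
              Finset.sum_congr rfl fun i _ => by
                rw [Finset.sum_mul]
                exact Finset.sum_congr rfl fun k _ => by split_ifs <;> simp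
        _ = ∑ k, ∑ i, (if a k = i then (q j k : ℂ) * ℓ i else 0) := Finset.sum_comm
        _ = ∑ k, (q j k : ℂ) * ℓ (a k) :=
              Finset.sum_congr rfl fun k _ => by
                rw [Finset.sum_ite_eq]; simp
    simp_rw [hNcast, sub_mul, Finset.sum_sub_distrib, h1, h2, ← hq' j, sub_self]
  · have h1 : ∑ j, γ j * (if i = j then (1:ℂ) else 0) = γ i := by
      simp only [mul_ite, mul_one, mul_zero, Finset.sum_ite_eq, Finset.mem_univ, if_true]
    have h2 : ∑ j, γ j * (∑ k, (if a k = i then (q j k : ℂ) else 0)) = 0 := by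
      calc ∑ j, γ j * (∑ k, (if a k = i then (q j k : ℂ) else 0))
            = ∑ j, ∑ k, (if a k = i then γ j * (q j k : ℂ) else 0) :=
              Finset.sum_congr rfl fun j _ => by
                rw [Finset.mul_sum]
                exact Finset.sum_congr rfl fun k _ => by split_ifs <;> simp
        _ = ∑ k, ∑ j, (if a k = i then γ j * (q j k : ℂ) else 0) := Finset.sum_comm
        _ = ∑ k, (if a k = i then ∑ j, γ j * (q j k : ℂ) else 0) :=
              Finset.sum_congr rfl fun k _ => by split_ifs <;> simp
        _ = 0 := by simp [hβ0]
    simp_rw [hNcast, mul_sub, Finset.sum_sub_distrib, h1, h2, sub_zero]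

end Literature.NumberTheory.Transcendental
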